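import Mathlib
import HarnessLib
import Summits.ValiantsHypothesis.ValiantsHypothesis.Theorems.MonotoneRestorationOrbitRestorationQPSignStableProducts
import Summits.ValiantsHypothesis.ValiantsHypothesis.Theorems.MonotoneRestorationOrbitRestorationQPColumnTransport

/-!
# Column-grouped families: products of row-atom polynomials transported up to units by the columns and rescaled by the rows

Route MonotoneRestoration, crux `OrbitRestorationQP` (stmt-ValiantsHypothesis-18293), SPAN-currency lane of the open
sub-rung A_∞ (`stub_sigmaPiSigmaValue`), `ΠΣ` part; the form of the PAIRING THEOREM
(`SuperAtoms.prod_mem_narrowSpan_of_signStable_rowAtomFactors`) that the block bookkeeping of a matrix-symmetric affine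
product delivers directly.  Helper (`--supports`), def-free.

Setting: a finite family `G_i ≠ 0` of polynomials in the row atoms of column cores of size `≤ c₀` (`2c₀ < n`) — in the
application, `G_T` = the product of all affine factors with column support `T` — such that
(rows) every row renaming rescales every `G_i` (`σ · G_i = u · G_i`);
(columns) every column renaming carries every `G_i` to a unit multiple of some `G_{κ i}`, `κ` a permutation;
(column-untwisted) no column renaming rescales a `G_i` non-trivially;
(invariance) the product `Π_i G_i` is row-invariant.

* `scalar_eq_of_mul_eq`, `rename_row_col_comm`, `rename_row_mul'` — small algebra;
* `rowMultiplier_eq_one_or_sign` — the row multipliers of each `G_i` form a multiplicative function, hence are `1` or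
  `sign` (`perm_character_eq_one_or_sign`), and column transport preserves which (`rowClass_eq_of_colTransport`);
* **`prod_mem_narrowSpan_of_colGrouped`** — under (rows), (columns), (column-untwisted), (invariance):
  `Π_i G_i ∈ span_ℂ {hom_{F,n} : tw F ≤ 2c₀ + 1}`.  Proof: rescale by the column-only cocycle trivialisation
  (`exists_rescaling_exactly_colPermuted`), split the family into the row-invariant class (untwisted companion
  `prod_mem_narrowSpan_of_rowInvariant_rowAtomFactors`) and the sign class, whose cardinality is even by (invariance)
  (a transposition acts by `−1` on an odd product), and apply the pairing theorem to the sign class.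

What remains for span-A₁ (every matrix-symmetric affine product narrow): (a) derive (rows)/(columns) for the column-label
groupings of `C a · Π L_i` from unique factorisation and the supports of `LocalFactors.exists_rowColSupports_of_matrixSymmetric`
(pattern: `NormalisedFactors.prod_goodBlocks_mem_narrowSpan`), together with the presentation of each grouping as a
row-atom polynomial (`LocalFormShape.eq_localForm_of_rowCol_invariant` with `R = univ`-free part); (b) the residue where
(column-untwisted) fails for the column groupings AND its mirror fails for the row groupings (doubly twisted type).
No registered stub is closed; the crux and VP ≠ VNP are not moved. [folklore; cite: DwivediPagoSeppelt2026, §8]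
-/

noncomputable section

-- `Summit.ValiantsHypothesis.ValiantsHypothesis.…` is the tree's single-conjunct layout (Sub = Summit).
set_option linter.dupNamespace false

namespace Summit.ValiantsHypothesis.ValiantsHypothesis.Theorems

namespace SuperAtoms

open MvPolynomial Finset Equiv
open Literature.Computability.AlgebraicComplexity (homPoly)
open Literature.Combinatorics.SimpleGraph (treewidth)

variable {n : ℕ}

/-! ### Small algebra -/

/-- Scalars on a nonzero polynomial are unique. [folklore] -/
theorem scalar_eq_of_mul_eq {G : MvPolynomial (Fin n × Fin n) ℂ} (hG : G ≠ 0) {u u' : ℂ}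
    (h : C u * G = C u' * G) : u = u' := by
  have h2 : C (u - u') * G = 0 := by rw [map_sub, sub_mul, h, sub_self]
  rcases mul_eq_zero.1 h2 with h3 | h3
  · rwa [C_eq_zero, sub_eq_zero] at h3
  · exact absurd h3 hG

/-- Row and column renamings commute. [folklore] -/
theorem rename_row_col_comm (σ τ : Perm (Fin n)) (p : MvPolynomial (Fin n × Fin n) ℂ) :
    rename (fun P : Fin n × Fin n => (σ P.1, P.2)) (rename (fun P : Fin n × Fin n => (P.1, τ P.2)) p) =
      rename (fun P : Fin n × Fin n => (P.1, τ P.2)) (rename (fun P : Fin n × Fin n => (σ P.1, P.2)) p) := by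
  rw [rename_rename, rename_rename]
  rfl

/-- Composition of row renamings. [folklore] -/
theorem rename_row_mul' (σ σ' : Perm (Fin n)) (p : MvPolynomial (Fin n × Fin n) ℂ) :
    rename (fun P : Fin n × Fin n => (σ P.1, P.2)) (rename (fun P : Fin n × Fin n => (σ' P.1, P.2)) p) =
      rename (fun P : Fin n × Fin n => ((σ * σ') P.1, P.2)) p := by
  rw [rename_rename]
  rfl

/-- The trivial row renaming is the identity. [folklore] -/
theorem rename_row_one' (p : MvPolynomial (Fin n × Fin n) ℂ) :
    rename (fun P : Fin n × Fin n => ((1 : Perm (Fin n)) P.1, P.2)) p = p := by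
  have h : (fun P : Fin n × Fin n => ((1 : Perm (Fin n)) P.1, P.2)) = id := by
    funext P
    rfl
  rw [h, rename_id]
  rfl

/-! ### Row multipliers -/

/-- **Row multipliers are `1` or `sign`.**  If every row renaming rescales `G ≠ 0`, the multiplier is a multiplicative
function of the renaming, hence identically `1` or the sign character. [folklore] -/
theorem rowMultiplier_eq_one_or_sign {G : MvPolynomial (Fin n × Fin n) ℂ} (hG : G ≠ 0) (v : Perm (Fin n) → ℂ)
    (hv : ∀ σ, rename (fun P : Fin n × Fin n => (σ P.1, P.2)) G = C (v σ) * G) :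
    (∀ σ, v σ = 1) ∨ (∀ σ, v σ = ((Equiv.Perm.sign σ : ℤˣ) : ℤ)) := by
  refine perm_character_eq_one_or_sign v (fun σ τ => ?_) ?_
  · apply scalar_eq_of_mul_eq hG
    rw [← hv, ← rename_row_mul', hv τ, map_mul, rename_C, hv σ, ← mul_assoc, ← map_mul, mul_comm (v τ)]
  · apply scalar_eq_of_mul_eq hG
    rw [← hv, rename_row_one', C_1, one_mul]

/-- **Column transport preserves the row multipliers** (rows and columns commute). [folklore] -/
theorem rowMultiplier_eq_of_colTransport {G G' : MvPolynomial (Fin n × Fin n) ℂ} (hG' : G' ≠ 0)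
    (v v' : Perm (Fin n) → ℂ)
    (hv : ∀ σ, rename (fun P : Fin n × Fin n => (σ P.1, P.2)) G = C (v σ) * G)
    (hv' : ∀ σ, rename (fun P : Fin n × Fin n => (σ P.1, P.2)) G' = C (v' σ) * G')
    {τ : Perm (Fin n)} {u : ℂ} (hu : u ≠ 0)
    (ht : rename (fun P : Fin n × Fin n => (P.1, τ P.2)) G = C u * G') (σ : Perm (Fin n)) : v σ = v' σ := by
  have h1 : rename (fun P : Fin n × Fin n => (σ P.1, P.2)) (rename (fun P : Fin n × Fin n => (P.1, τ P.2)) G) =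
      C (u * v' σ) * G' := by
    rw [ht, map_mul, rename_C, hv', ← mul_assoc, ← map_mul]
  have h2 : rename (fun P : Fin n × Fin n => (σ P.1, P.2)) (rename (fun P : Fin n × Fin n => (P.1, τ P.2)) G) =
      C (u * v σ) * G' := by
    rw [rename_row_col_comm, hv, map_mul, rename_C, ht, ← mul_assoc, ← map_mul, mul_comm (v σ)]
  have h3 := scalar_eq_of_mul_eq hG' (h2.symm.trans h1)
  exact mul_left_cancel₀ hu h3

/-! ### The column-grouped product theorem -/

/-- **COLUMN-GROUPED PRODUCTS ARE NARROW.**  Let `G_i ≠ 0` (`i ∈ ι`) be polynomials in the row atoms of column cores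
of size `≤ c₀` (`2c₀ < n`) such that every row renaming rescales every `G_i`, every column renaming carries every `G_i`
to a unit multiple of `G_{κ i}` for a permutation `κ`, no column renaming rescales a `G_i` non-trivially, and `Π_i G_i`
is row-invariant.  Then `Π_i G_i ∈ span_ℂ {hom_{F,n} : tw F ≤ 2c₀ + 1}`.
[folklore; cite: DwivediPagoSeppelt2026, §8; Weyl1939, Chap. II §3; Macdonald1995, §I.2] -/
theorem prod_mem_narrowSpan_of_colGrouped (c₀ : ℕ) (hc₀ : 2 * c₀ < n) {ι : Type} [Fintype ι]
    (G : ι → MvPolynomial (Fin n × Fin n) ℂ) (hG0 : ∀ i, G i ≠ 0)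
    (hloc : ∀ i, ∃ (c : ℕ) (ψ : Fin c → Fin n) (P : MvPolynomial (Fin n × (Fin c ⊕ Unit)) ℂ), c ≤ c₀ ∧
      G i = aeval (fun w : Fin n × (Fin c ⊕ Unit) =>
        Sum.elim (fun b : Fin c => (X (w.1, ψ b) : MvPolynomial (Fin n × Fin n) ℂ))
          (fun _ : Unit => ∑ j : Fin n, (X (w.1, j) : MvPolynomial (Fin n × Fin n) ℂ)) w.2) P)
    (hrow : ∀ (σ : Perm (Fin n)) (i : ι), ∃ u : ℂ, rename (fun P : Fin n × Fin n => (σ P.1, P.2)) (G i) = C u * G i)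
    (hcol : ∀ τ : Perm (Fin n), ∃ κ : Perm ι, ∀ i, ∃ u : ℂ, u ≠ 0 ∧
      rename (fun P : Fin n × Fin n => (P.1, τ P.2)) (G i) = C u * G (κ i))
    (hcolfree : ∀ (τ : Perm (Fin n)) (i : ι) (u : ℂ),
      rename (fun P : Fin n × Fin n => (P.1, τ P.2)) (G i) = C u * G i → u = 1)
    (hinv : ∀ σ : Perm (Fin n), rename (fun P : Fin n × Fin n => (σ P.1, P.2)) (∏ i, G i) = ∏ i, G i) :
    (∏ i, G i) ∈ Submodule.span ℂ {p : MvPolynomial (Fin n × Fin n) ℂ |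
        ∃ (a b : ℕ) (E : Multiset (Fin a × Fin b)),
          treewidth (SimpleGraph.fromRel fun u v : Fin a ⊕ Fin b =>
            ∃ e ∈ E, u = Sum.inl e.1 ∧ v = Sum.inr e.2) ≤ 2 * c₀ + 1 ∧ p = homPoly E n ℂ} := by
  classical
  -- row multipliers
  choose v hv using hrow
  have hvclass : ∀ i, (∀ σ, v σ i = 1) ∨ (∀ σ, v σ i = ((Equiv.Perm.sign σ : ℤˣ) : ℤ)) :=
    fun i => rowMultiplier_eq_one_or_sign (hG0 i) (fun σ => v σ i) (fun σ => hv σ i)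
  have hvsq : ∀ σ i, v σ i * v σ i = 1 := by
    intro σ i
    rcases hvclass i with h | h
    · rw [h, one_mul]
    · rw [h, ← Int.cast_mul, ← Units.val_mul, Int.units_mul_self, Units.val_one, Int.cast_one]
  -- column normalisation
  choose κ hκ using hcol
  obtain ⟨d, hd0, hexact⟩ := exists_rescaling_exactly_colPermuted G hG0 κ
    (fun τ i => hκ τ i) hcolfree
  set G' : ι → MvPolynomial (Fin n × Fin n) ℂ := fun i => C (d i) * G i with hG'
  have hG'0 : ∀ i, G' i ≠ 0 := fun i => mul_ne_zero (by rw [Ne, C_eq_zero]; exact hd0 i) (hG0 i)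
  have hv' : ∀ σ i, rename (fun P : Fin n × Fin n => (σ P.1, P.2)) (G' i) = C (v σ i) * G' i := by
    intro σ i
    simp only [hG', map_mul, rename_C, hv]
    ring
  have hloc' : ∀ i, ∃ (c : ℕ) (ψ : Fin c → Fin n) (P : MvPolynomial (Fin n × (Fin c ⊕ Unit)) ℂ), c ≤ c₀ ∧
      G' i = aeval (fun w : Fin n × (Fin c ⊕ Unit) =>
        Sum.elim (fun b : Fin c => (X (w.1, ψ b) : MvPolynomial (Fin n × Fin n) ℂ))
          (fun _ : Unit => ∑ j : Fin n, (X (w.1, j) : MvPolynomial (Fin n × Fin n) ℂ)) w.2) P := by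
    intro i
    obtain ⟨c, ψ, P, hc, hP⟩ := hloc i
    refine ⟨c, ψ, C (d i) * P, hc, ?_⟩
    rw [map_mul, algHom_C, algebraMap_eq, ← hP]
  -- the two row classes; exact column transport preserves them
  set p : ι → Prop := fun i => ∀ σ, v σ i = 1 with hp
  have hsign : ∀ i, ¬ p i → ∀ σ, v σ i = ((Equiv.Perm.sign σ : ℤˣ) : ℤ) := by
    intro i hi
    rcases hvclass i with h | h
    · exact absurd h hi
    · exact h
  have hpres : ∀ (τ : Perm (Fin n)) (κ' : Perm ι),
      (∀ i, rename (fun P : Fin n × Fin n => (P.1, τ P.2)) (G' i) = G' (κ' i)) → ∀ i, p (κ' i) ↔ p i := by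
    intro τ κ' h i
    have hvv : ∀ σ, v σ i = v σ (κ' i) := fun σ =>
      rowMultiplier_eq_of_colTransport (hG'0 (κ' i)) (fun σ => v σ i) (fun σ => v σ (κ' i))
        (fun σ => hv' σ i) (fun σ => hv' σ (κ' i)) one_ne_zero (by rw [C_1, one_mul, h i]) σ
    simp only [hp, hvv]
  -- the two sub-families
  have hcol₁ : ∀ τ : Perm (Fin n), ∃ κ₁ : Perm {i // p i}, ∀ i : {i // p i},
      rename (fun P : Fin n × Fin n => (P.1, τ P.2)) (G' i) = G' (κ₁ i) := by
    intro τ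
    obtain ⟨κ', hκ'⟩ := hexact τ
    refine ⟨κ'.subtypePerm (hpres τ κ' hκ'), fun i => ?_⟩
    rw [Equiv.Perm.subtypePerm_apply]
    exact hκ' i
  have hcol₂ : ∀ τ : Perm (Fin n), ∃ κ₂ : Perm {i // ¬ p i}, ∀ i : {i // ¬ p i},
      rename (fun P : Fin n × Fin n => (P.1, τ P.2)) (G' i) = G' (κ₂ i) := by
    intro τ
    obtain ⟨κ', hκ'⟩ := hexact τ
    refine ⟨κ'.subtypePerm (fun i => not_congr (hpres τ κ' hκ' i)), fun i => ?_⟩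
    rw [Equiv.Perm.subtypePerm_apply]
    exact hκ' i
  have h₁ : (∏ i : {i // p i}, G' i) ∈ Submodule.span ℂ {q : MvPolynomial (Fin n × Fin n) ℂ |
        ∃ (a b : ℕ) (E : Multiset (Fin a × Fin b)),
          treewidth (SimpleGraph.fromRel fun u v : Fin a ⊕ Fin b =>
            ∃ e ∈ E, u = Sum.inl e.1 ∧ v = Sum.inr e.2) ≤ 2 * c₀ + 1 ∧ q = homPoly E n ℂ} := by
    refine (Submodule.span_mono ?_) (prod_mem_narrowSpan_of_rowInvariant_rowAtomFactors n c₀ (by omega)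
      (fun i : {i // p i} => G' i) (fun σ i => ?_) hcol₁ (fun i => hloc' i))
    · rintro q ⟨a, b, E, hE, rfl⟩
      exact ⟨a, b, E, hE.trans (by omega), rfl⟩
    · rw [hv', i.2 σ, C_1, one_mul]
  -- parity of the sign class
  have hprodG' : (∏ i, G' i) = C (∏ i, d i) * ∏ i, G i := by
    simp only [hG', Finset.prod_mul_distrib, map_prod]
  have hsplit := (Fintype.prod_subtype_mul_prod_subtype p G').symm
  have hrow₁ : ∀ σ : Perm (Fin n), rename (fun P : Fin n × Fin n => (σ P.1, P.2)) (∏ i : {i // p i}, G' i) =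
      ∏ i : {i // p i}, G' i := by
    intro σ
    rw [map_prod]
    exact Finset.prod_congr rfl fun i _ => by rw [hv', i.2 σ, C_1, one_mul]
  have hrow₂ : ∀ σ : Perm (Fin n), rename (fun P : Fin n × Fin n => (σ P.1, P.2)) (∏ i : {i // ¬ p i}, G' i) =
      C ((((Equiv.Perm.sign σ : ℤˣ) : ℤ) : ℂ) ^ Fintype.card {i // ¬ p i}) * ∏ i : {i // ¬ p i}, G' i := by
    intro σ
    rw [map_prod]
    have : ∀ i : {i // ¬ p i}, rename (fun P : Fin n × Fin n => (σ P.1, P.2)) (G' i) =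
        C (((Equiv.Perm.sign σ : ℤˣ) : ℤ) : ℂ) * G' i := fun i => by rw [hv', hsign i i.2 σ]
    simp_rw [this]
    rw [Finset.prod_mul_distrib, Finset.prod_const, Finset.card_univ, map_pow]
  have heven : Even (Fintype.card {i // ¬ p i}) := by
    by_contra hodd
    rw [Nat.not_even_iff_odd] at hodd
    -- a transposition acts by −1 on the odd product, contradicting invariance
    have hn2 : 2 ≤ n := by
      by_contra hlt
      have hsub : ∀ σ : Perm (Fin n), σ = 1 := fun σ => Equiv.ext fun x => by
        have := x.isLt; have := (σ x).isLt; exact Fin.ext (by omega)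
      have hall : ∀ i, p i := fun i σ => by
        rw [hsub σ]
        apply scalar_eq_of_mul_eq (hG0 i)
        rw [← hv 1 i, rename_row_one', C_1, one_mul]
      have : Fintype.card {i // ¬ p i} = 0 := Fintype.card_eq_zero_iff.2 ⟨fun i => i.2 (hall i)⟩
      rw [this] at hodd
      exact (Nat.not_odd_zero hodd).elim
    set σ₀ : Perm (Fin n) := swap (⟨0, by omega⟩ : Fin n) ⟨1, by omega⟩ with hσ₀
    have hsgn : (((Equiv.Perm.sign σ₀ : ℤˣ) : ℤ) : ℂ) = -1 := by
      rw [hσ₀, Equiv.Perm.sign_swap (fun h => by simp [Fin.ext_iff] at h)]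
      simp
    have hX : rename (fun P : Fin n × Fin n => (σ₀ P.1, P.2)) (∏ i, G' i) = - ∏ i, G' i := by
      rw [hsplit, map_mul, hrow₁, hrow₂, hsgn, Odd.neg_one_pow hodd, map_neg, C_1]
      ring
    have hX' : rename (fun P : Fin n × Fin n => (σ₀ P.1, P.2)) (∏ i, G' i) = ∏ i, G' i := by
      rw [hprodG', map_mul, rename_C, hinv]
    have hzero : (∏ i, G' i) = 0 := by
      have h2 : (2 : ℂ) • (∏ i, G' i) = 0 := by
        rw [two_smul]
        nth_rewrite 1 [← hX']
        rw [hX, neg_add_cancel]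
      exact (smul_eq_zero.1 h2).resolve_left two_ne_zero
    exact (Finset.prod_ne_zero_iff.2 fun i _ => hG'0 i) hzero
  have h₂ : (∏ i : {i // ¬ p i}, G' i) ∈ Submodule.span ℂ {q : MvPolynomial (Fin n × Fin n) ℂ |
        ∃ (a b : ℕ) (E : Multiset (Fin a × Fin b)),
          treewidth (SimpleGraph.fromRel fun u v : Fin a ⊕ Fin b =>
            ∃ e ∈ E, u = Sum.inl e.1 ∧ v = Sum.inr e.2) ≤ 2 * c₀ + 1 ∧ q = homPoly E n ℂ} :=
    prod_mem_narrowSpan_of_signStable_rowAtomFactors n c₀ hc₀ heven (fun i : {i // ¬ p i} => G' i)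
      (fun σ => (((Equiv.Perm.sign σ : ℤˣ) : ℤ) : ℂ))
      (fun σ => by rw [← Int.cast_mul, ← Units.val_mul, Int.units_mul_self, Units.val_one, Int.cast_one])
      (fun σ i => by rw [hv', hsign i i.2 σ]) hcol₂ (fun i => hloc' i)
  -- assemble
  have hd : (∏ i, d i) ≠ 0 := Finset.prod_ne_zero_iff.2 fun i _ => hd0 i
  have hGG : (∏ i, G i) = (∏ i, d i)⁻¹ • ((∏ i : {i // p i}, G' i) * ∏ i : {i // ¬ p i}, G' i) := by
    rw [← hsplit, hprodG', smul_eq_C_mul, ← mul_assoc, ← map_mul, inv_mul_cancel₀ hd, C_1, one_mul]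
  rw [hGG]
  exact Submodule.smul_mem _ _ (NarrowSpanAlgebra.narrowSpan_mul_mem n (2 * c₀ + 1) h₁ h₂)

end SuperAtoms

end Summit.ValiantsHypothesis.ValiantsHypothesis.Theorems

end
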